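import Mathlib
import Literature.Combinatorics.Optimization.BlockPsdLiftFactorization
import Literature.Barriers.PneNP.TSPExtensionComplexity
import HarnessLib

/-!
# Braun–Fiorini–Pokutta–Steurer 2012: approximate extended formulations of the hard pair `(COR(n), Q(n))`

G. Braun, S. Fiorini, S. Pokutta, D. Steurer, *Approximation Limits of Linear Programs (Beyond Hierarchies)*,
FOCS 2012, arXiv:1204.0957 [BraunEtAl2012]; journal version Math. Oper. Res. 40 (2015) 756–772 [BraunEtAl2015].
Theorem numbers and pages below are those of arXiv:1204.0957 (§4.1, p. 13).

THE HARD PAIR (§4.1, p. 13).  Inner polytope `P = COR(n) = conv{b bᵀ : b ∈ {0,1}ⁿ}` — the tree's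
`FixedSizePsdRank.corPolytope n ⊂ ℝ^{n²}` (flattened coordinates, `FixedSizePsdRank.flat` / `vecOuter`); outer polyhedron
`Q(n) = {x ∈ ℝ^{n×n} : ⟨2·diag(a) − a aᵀ, x⟩ ≤ 1 for all a ∈ {0,1}ⁿ}` (Frobenius pairing).  `P ⊆ Q`, and the slack
matrix of the pair is UDISJ: `S^{P,Q}_{ab} = (1 − aᵀb)²` (the tree's `FixedSizePsdRank.udisj`); for `ρ ≥ 1` the slack matrix
of `(P, ρQ)` is the `ρ`-extension `(1 − aᵀb)² + ρ − 1`.  An EXTENDED FORMULATION OF THE PAIR `(P, Q')` (§2.3, p. 6) is a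
slack-form system `E x + F y = g, y ≥ 0` whose projection `K` satisfies `P ⊆ K ⊆ Q'`; its size is the number of
inequalities (`y`-variables) — the tree's `Literature.Barriers.PneNP.HasEFOfSize K r`; `xc(P, Q')` is the least size.

CONTENT.
* `corCliqueMat a = 2·diag(a) − a aᵀ` and the dilated outer polyhedron `corOuter n ρ = ρ·Q(n)`, with the sanity facts that pin the
  pair down: `flat_corCliqueMat_dotProduct_vecOuter` (`⟨2 diag(a) − aaᵀ, x xᵀ⟩ = 2 Σ aᵢxᵢ − (Σ aᵢxᵢ)²` on 0/1 points),
  `one_sub_flat_corCliqueMat_dotProduct_vecOuter` (slack `= udisj n a b = (1 − aᵀb)²`), `corPolytope_subset_corOuter_one` (`P ⊆ Q`),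
  `corOuter_eq_smul_corOuter_one` (`corOuter n ρ = ρ • Q(n)` for `ρ > 0`), `corOuter_mono`.
* **The named fact `BFPS2012_corSandwichHard` = Theorem 6, second clause** («if `ρ = O(n^β)` for some constant `β < 1/2`, then
  `xc(P, ρQ) = 2^{Ω(n^{1−2β})}`»), typed with the constants existential as printed and `β ∈ [0, 1/2)`; NOT proved here.
  Its first clause («`ρ` a fixed constant ⇒ `xc(P, ρQ) = 2^{Ω(n)}`») is the case `β = 0` and is DERIVED:
  `BFPS2012_corSandwichHard.fixedRatio`.
* Print proof route (for a future discharge, size L/XL): Thm 6 ⇐ Thm 1 (p. 7: `rank₊(S^{P,Q}) − 1 ≤ xc(P,Q)`) + Thm 5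
  (pp. 11–12: `ρ`-extensions of UDISJ have `rank₊ = 2^{Ω(n^{1−2β})}`) ⇐ Razborov's rectangle-corruption lemma.
  Improved range `ρ = n^{1−ε}`: Braverman–Moitra, STOC 2013, Thm 1 (not typed here).

What is NOT here: no proof of Theorem 6; no CLIQUE encoding (§4.2) and no SDP inapproximability (§4.3); no restatement of
`corPolytope` / `udisj` / `HasEFOfSize` (imported).  Consumer: the KNOWN stub `stub_corSandwichHard` of the line
`Summits/ValiantsHypothesis/…/Cruxes/NNDivisionHard/Lines/virtual_passenger.lean` (the case `β = 1/4`), bridged Summits-side.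
-/

noncomputable section

open Matrix Finset
open scoped Pointwise

namespace Literature.Combinatorics.Optimization

open FixedSizePsdRank (Cube bvec vecOuter flat corPolytope ip udisj)
open Literature.Barriers.PneNP (HasEFOfSize)

variable {n : ℕ}

/-- BFPS's **clique matrix** `2·diag(a) − a aᵀ ∈ ℝ^{n×n}` of a 0/1 vector `a ∈ {0,1}ⁿ` — the normal vector of the facet
`⟨2·diag(a) − a aᵀ, x⟩ ≤ 1` of the outer polyhedron `Q(n)`. [cite: BraunEtAl2012, §4.1 (p. 13)] -/
def corCliqueMat (a : Cube n) : Matrix (Fin n) (Fin n) ℝ :=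
  (2 : ℝ) • Matrix.diagonal (bvec a) - Matrix.vecMulVec (bvec a) (bvec a)

/-- BFPS's **outer polyhedron, dilated by `ρ`**: `corOuter n ρ = {x ∈ ℝ^{n²} : ⟨2·diag(a) − a aᵀ, x⟩ ≤ ρ for all a ∈ {0,1}ⁿ}`;
`corOuter n 1 = Q(n)` and `corOuter n ρ = ρ • Q(n)` for `ρ > 0` (`corOuter_eq_smul_corOuter_one`).
[cite: BraunEtAl2012, §4.1 (p. 13)] -/
def corOuter (n : ℕ) (ρ : ℝ) : Set (Fin (n * n) → ℝ) :=
  {x | ∀ a : Cube n, flat (corCliqueMat a) ⬝ᵥ x ≤ ρ}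

/-- Membership in the dilated outer polyhedron, unfolded. [cite: BraunEtAl2012, §4.1 (p. 13)] -/
theorem mem_corOuter {ρ : ℝ} {x : Fin (n * n) → ℝ} :
    x ∈ corOuter n ρ ↔ ∀ a : Cube n, flat (corCliqueMat a) ⬝ᵥ x ≤ ρ := Iff.rfl

/-- `⟨2·diag(a) − a aᵀ, x xᵀ⟩ = 2·Σᵢ aᵢ xᵢ² − (Σᵢ aᵢ xᵢ)²`. [cite: BraunEtAl2012, §4.1 (p. 13)] -/
theorem flat_corCliqueMat_dotProduct_vecOuter (a : Cube n) (x : Fin n → ℝ) :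
    flat (corCliqueMat a) ⬝ᵥ vecOuter n x =
      2 * ∑ i, bvec a i * (x i * x i) - (∑ i, bvec a i * x i) ^ 2 := by
  rw [FixedSizePsdRank.flat_dotProduct_vecOuter]
  simp only [corCliqueMat, Matrix.sub_apply, Matrix.smul_apply, Matrix.diagonal_apply, Matrix.vecMulVec_apply,
    smul_eq_mul, sub_mul, Finset.sum_sub_distrib]
  congr 1
  · rw [Finset.mul_sum]
    refine Finset.sum_congr rfl fun i _ => ?_
    rw [Finset.sum_eq_single i]
    · simp
      ring
    · intro j _ hji
      simp [Ne.symm hji]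
    · intro hi; exact absurd (Finset.mem_univ i) hi
  · rw [sq, Finset.sum_mul_sum]
    refine Finset.sum_congr rfl fun i _ => Finset.sum_congr rfl fun j _ => ?_
    ring

/-- On a 0/1 point: `⟨2·diag(a) − a aᵀ, b bᵀ⟩ = 2|a ∩ b| − |a ∩ b|²`, i.e. **the slack of the pair `(COR(n), Q(n))` is UDISJ**:
`1 − ⟨2·diag(a) − a aᵀ, b bᵀ⟩ = (1 − aᵀb)² = udisj n a b`. [cite: BraunEtAl2012, §4.1 (p. 13), «S^{P,Q}_{ab} = (1 − aᵀb)²»] -/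
theorem one_sub_flat_corCliqueMat_dotProduct_vecOuter (a b : Cube n) :
    1 - flat (corCliqueMat a) ⬝ᵥ vecOuter n (bvec b) = udisj n a b := by
  rw [flat_corCliqueMat_dotProduct_vecOuter]
  have hsq : ∀ i, bvec b i * bvec b i = bvec b i := fun i => by
    rcases FixedSizePsdRank.bvec_zero_or_one b i with h | h <;> simp [h]
  simp only [hsq]
  have hip : ∑ i, bvec a i * bvec b i = (ip a b : ℝ) := by
    rw [FixedSizePsdRank.ip_eq_sum]
    push_cast
    refine Finset.sum_congr rfl fun i _ => ?_
    by_cases ha : a i = true <;> by_cases hb : b i = true <;> simp [bvec, ha, hb]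
  rw [hip, udisj]
  ring

/-- **`P ⊆ Q`**: every clique inequality `⟨2·diag(a) − a aᵀ, x⟩ ≤ 1` is valid on `COR(n)` (at a vertex `b bᵀ` the slack is
`(1 − aᵀb)² ≥ 0`, and the constraint is linear in `x`). [cite: BraunEtAl2012, §4.1 (p. 13), «P ⊆ Q»] -/
theorem corPolytope_subset_corOuter_one : corPolytope n ⊆ corOuter n 1 := by
  intro x hx a
  refine FixedSizePsdRank.flat_dotProduct_le_of_mem_corPolytope hx ⟨(corCliqueMat a, 1), fun y hy => ?_⟩
  show ∑ i, ∑ j, corCliqueMat a i j * (y i * y j) ≤ 1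
  rw [← FixedSizePsdRank.flat_dotProduct_vecOuter, flat_corCliqueMat_dotProduct_vecOuter]
  have hsq : ∀ i, y i * y i = y i := fun i => by rcases hy i with h | h <;> simp [h]
  simp only [hsq]
  nlinarith [sq_nonneg (∑ i, bvec a i * y i - 1)]

/-- `corOuter` is monotone in the level `ρ`. [cite: BraunEtAl2012, §4.1 (p. 13)] -/
theorem corOuter_mono {ρ ρ' : ℝ} (h : ρ ≤ ρ') : corOuter n ρ ⊆ corOuter n ρ' :=
  fun _ hx a => (hx a).trans h

/-- **`corOuter n ρ` is the dilate `ρ • Q(n)`** for `ρ > 0` (so the sandwich `COR(n) ⊆ K ⊆ corOuter n ρ` below is literally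
BFPS's `P ⊆ K ⊆ ρQ`). [cite: BraunEtAl2012, §4.1 (p. 13)] -/
theorem corOuter_eq_smul_corOuter_one {ρ : ℝ} (hρ : 0 < ρ) : corOuter n ρ = ρ • corOuter n 1 := by
  ext x
  constructor
  · intro hx
    refine ⟨ρ⁻¹ • x, fun a => ?_, by simp [smul_smul, mul_inv_cancel₀ hρ.ne']⟩
    rw [dotProduct_smul, smul_eq_mul]
    have := hx a
    rw [inv_mul_le_iff₀ hρ]
    simpa using this
  · rintro ⟨y, hy, rfl⟩ a
    have := hy a
    show flat (corCliqueMat a) ⬝ᵥ (ρ • y) ≤ ρ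
    rw [dotProduct_smul, smul_eq_mul]
    nlinarith

/-- **Braun–Fiorini–Pokutta–Steurer 2012, Theorem 6 (second clause) — lower bounds for approximate EFs of the hard pair.**
«Let `ρ ≥ 1`, let `n` be a positive integer and let `P = COR(n)`, `Q = Q(n)`.  If `ρ = O(n^β)` for some constant `β < 1/2`,
then `xc(P, ρQ) = 2^{Ω(n^{1−2β})}`.»  Typed with the `O`/`Ω` constants existential and `β ∈ [0, 1/2)`: for every such `β` and
every `C > 0` there are `c > 0` and `n₀` such that for all `n ≥ n₀` and all `ρ` with `1 ≤ ρ ≤ C·n^β`, every `K ⊆ ℝ^{n²}` with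
`COR(n) ⊆ K ⊆ ρ·Q(n)` that is the projection of a slack-form extended formulation with `r` inequalities has `2^{c·n^{1−2β}} ≤ r`.
(Uniformity in `ρ ≤ C n^β` is the printed statement for the sequence `ρ(n) = max(1, C n^β)` plus monotonicity of `ρ ↦ ρQ`,
`corOuter_mono`.)  NAMED FACT, not proved in the tree; print proof: Thm 1 (p. 7) + Thm 5 (pp. 11–12, from Razborov's lemma).
[cite: BraunEtAl2012, Thm 6 (§4.1, p. 13)] -/
def BFPS2012_corSandwichHard : Prop :=
  ∀ β : ℝ, 0 ≤ β → β < 1 / 2 → ∀ C : ℝ, 0 < C →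
    ∃ c : ℝ, 0 < c ∧ ∃ n₀ : ℕ, ∀ n : ℕ, n₀ ≤ n → ∀ ρ : ℝ, 1 ≤ ρ → ρ ≤ C * (n : ℝ) ^ β →
      ∀ (K : Set (Fin (n * n) → ℝ)) (r : ℕ),
        corPolytope n ⊆ K → K ⊆ corOuter n ρ → HasEFOfSize K r →
          (2 : ℝ) ^ (c * (n : ℝ) ^ (1 - 2 * β)) ≤ r

/-- **Theorem 6, first clause, from the second** («if `ρ` is a fixed constant, then `xc(P, ρQ) = 2^{Ω(n)}`»): the case `β = 0`,
`C = ρ`. [cite: BraunEtAl2012, Thm 6 (§4.1, p. 13)] -/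
theorem BFPS2012_corSandwichHard.fixedRatio (h : BFPS2012_corSandwichHard) (ρ : ℝ) (hρ : 1 ≤ ρ) :
    ∃ c : ℝ, 0 < c ∧ ∃ n₀ : ℕ, ∀ n : ℕ, n₀ ≤ n → ∀ (K : Set (Fin (n * n) → ℝ)) (r : ℕ),
      corPolytope n ⊆ K → K ⊆ corOuter n ρ → HasEFOfSize K r → (2 : ℝ) ^ (c * (n : ℝ)) ≤ r := by
  obtain ⟨c, hc, n₀, hn₀⟩ := h 0 le_rfl (by norm_num) ρ (lt_of_lt_of_le zero_lt_one hρ)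
  refine ⟨c, hc, n₀, fun n hn K r hP hQ hEF => ?_⟩
  have := hn₀ n hn ρ hρ (by simp) K r hP hQ hEF
  simpa using this

end Literature.Combinatorics.Optimization
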